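import Summits.CriticalPhenomena.PercolationContinuityZ3.Theorems.PercNearOneGluingNoHeavyPcintBSMCompute
import HarnessLib

/-!
# PCINT lane, PHASE 5 (block-renewal second moment): symmetries of the certificate functional

Cell `prim-pcint`, seat `prim-pcint-1` (gen 14); memo `run/shared/lean/prim/pcint/T-FIBRE-ROUTE.md` §PHASE 5.

The certificate functional `BSM.certLHS … y` is invariant under `y ↦ -y` (**`BSM.certLHS_neg`**: swap the two block
words; no hypothesis on the piece family), under coordinate permutations `y ↦ y ∘ p⁻¹` (**`BSM.certLHS_perm`**) and
under coordinate sign flips (**`BSM.certLHS_flip`**) when the piece family is closed under the map (a reindexing `π` of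
the pieces) — via equivariance of the transverse edge keys (`BSM.tedges_perm`; `BSM.tedges_flip`, where an edge along
the flipped axis moves its lower vertex) — provided the tables `V̂₀, V̂₁` are invariant; tables of the form `f ∘ canonK`
are (`BSM.canonK_neg`, `BSM.canonK_pv`, `BSM.canonK_negC`).  So the certificate inequalities need only be kernel-checked
on orbit representatives of the hyperoctahedral group (10 instead of 125 offsets for `t = 3`; `…PcintBSMSym3`).
-/

namespace Summit.CriticalPhenomena.PercolationContinuityZ3.Theorems.Pcint.BSM

open Finset

variable {t k np : ℕ}

/-! ### The antipodal symmetry `y ↦ -y` -/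

/-- Shifting by `-y` then by `y` is the identity. -/
theorem shiftE_neg_trans (y : Fin t → ℤ) :
    (shiftE (k := k) (-y)).trans (shiftE y) = Function.Embedding.refl _ := by
  ext q <;> simp [shiftE, Function.Embedding.trans]

/-- **`S (-y) σ σ' = S y σ' σ`.** -/
theorem S_neg (pc : Fin np → List (Fin t × Bool)) (k : ℕ) (y : Fin t → ℤ) (σ σ' : Fin np) :
    S pc k (-y) σ σ' = S pc k y σ' σ := by
  unfold S
  rw [← Finset.card_map (shiftE y), Finset.map_inter, Finset.map_map, shiftE_neg_trans, Finset.map_refl,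
    Finset.inter_comm]

/-- **The certificate functional is even in `y`** (for even tables). -/
theorem certLHS_neg (pc : Fin np → List (Fin t × Bool)) (w : Fin np → ℝ) (k : ℕ) (x : ℝ)
    {V0f V1f : (Fin t → ℤ) → ℝ} (hV0 : ∀ u, V0f (-u) = V0f u) (hV1 : ∀ u, V1f (-u) = V1f u) (y : Fin t → ℤ) :
    certLHS pc w k x V0f V1f (-y) = certLHS pc w k x V0f V1f y := by
  unfold certLHS
  rw [Finset.sum_comm]
  refine sum_congr rfl fun σ _ => sum_congr rfl fun σ' _ => ?_
  rw [S_neg, mul_comm (w σ') (w σ)]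
  have he : (pend (pc σ') = pend (pc σ) + -y) ↔ (pend (pc σ) = pend (pc σ') + y) := by
    constructor <;> intro h <;> rw [h] <;> abel
  have hu : -y + (pend (pc σ) - pend (pc σ')) = -(y + (pend (pc σ') - pend (pc σ))) := by abel
  rw [hu, hV0, hV1]
  by_cases h : pend (pc σ) = pend (pc σ') + y
  · rw [if_pos h, if_pos (he.2 h)]
  · rw [if_neg h, if_neg (fun h' => h (he.1 h'))]

/-! ### Coordinate permutations -/

/-- The action of a coordinate permutation on vectors: `(p • v) (p i) = v i`. -/
def pv (p : Equiv.Perm (Fin t)) (v : Fin t → ℤ) : Fin t → ℤ := fun i => v (p.symm i)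

/-- The action on signed axes. -/
def pq (p : Equiv.Perm (Fin t)) (q : Fin t × Bool) : Fin t × Bool := (p q.1, q.2)

/-- `pv` is additive. -/
theorem pv_add (p : Equiv.Perm (Fin t)) (v w : Fin t → ℤ) : pv p (v + w) = pv p v + pv p w := rfl

/-- `pv` commutes with negation. -/
theorem pv_neg (p : Equiv.Perm (Fin t)) (v : Fin t → ℤ) : pv p (-v) = -pv p v := rfl

/-- `pv` commutes with subtraction. -/
theorem pv_sub (p : Equiv.Perm (Fin t)) (v w : Fin t → ℤ) : pv p (v - w) = pv p v - pv p w := rfl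

/-- `pv p 0 = 0`. -/
theorem pv_zero (p : Equiv.Perm (Fin t)) : pv p (0 : Fin t → ℤ) = 0 := rfl

/-- `pv` is injective. -/
theorem pv_injective (p : Equiv.Perm (Fin t)) : Function.Injective (pv p) := by
  intro v w h
  funext i
  have := congr_fun h (p i)
  simpa [pv] using this

/-- Step vectors are equivariant. -/
theorem pv_sv (p : Equiv.Perm (Fin t)) (q : Fin t × Bool) : pv p (sv q) = sv (pq p q) := by
  funext i
  unfold pv sv pq
  by_cases h : i = p q.1
  · subst h; simp
  · rw [Pi.single_eq_of_ne (fun h' => h (by rw [← h']; simp)), Pi.single_eq_of_ne h]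

/-- The action on edge keys. -/
def pK (p : Equiv.Perm (Fin t)) (k : ℕ) : LKey t k ↪ LKey t k :=
  ⟨fun q => (pv p q.1, Sum.map p id q.2), fun q q' h => by
    simp only [Prod.mk.injEq] at h
    refine Prod.ext (pv_injective p h.1) ?_
    have := h.2
    rcases q with ⟨_, a | a⟩ <;> rcases q' with ⟨_, b | b⟩ <;> simp_all⟩

/-- **Equivariance of the transverse edge keys under coordinate permutations.** -/
theorem tedges_perm (p : Equiv.Perm (Fin t)) (k : ℕ) : ∀ (u : Fin t → ℤ) (σ : List (Fin t × Bool)),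
    tedges k (pv p u) (σ.map (pq p)) = (tedges k u σ).map (pK p k)
  | u, [] => by simp [tedges]
  | u, q :: σ => by
    rw [List.map_cons, tedges, tedges, Finset.map_insert, ← tedges_perm p k (u + sv q) σ, pv_add, pv_sv]
    congr 1
    rcases q with ⟨i, b⟩
    cases b <;> simp [pq, pK, pv_add, pv_sv]

/-- Piece endpoints are equivariant. -/
theorem pend_perm (p : Equiv.Perm (Fin t)) : ∀ σ : List (Fin t × Bool), pend (σ.map (pq p)) = pv p (pend σ)
  | [] => by simp [pend, pv_zero]
  | q :: σ => by
    have ih := pend_perm p σ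
    simp only [pend, List.map_cons, List.sum_cons] at ih ⊢
    rw [ih, pv_add, pv_sv]

/-- Shifts are equivariant. -/
theorem shiftE_trans_pK (p : Equiv.Perm (Fin t)) (k : ℕ) (y : Fin t → ℤ) :
    (shiftE (k := k) y).trans (pK p k) = (pK p k).trans (shiftE (pv p y)) := by
  ext q <;> simp [shiftE, pK, pv_add, Function.Embedding.trans]

/-- **`S` is invariant under coordinate permutations** of the offset and of the pieces. -/
theorem S_perm (pc : Fin np → List (Fin t × Bool)) (k : ℕ) (p : Equiv.Perm (Fin t)) (π : Fin np → Fin np)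
    (hπ : ∀ σ, pc (π σ) = (pc σ).map (pq p)) (y : Fin t → ℤ) (σ σ' : Fin np) :
    S pc k (pv p y) (π σ) (π σ') = S pc k y σ σ' := by
  unfold S
  have h1 := tedges_perm p k 0 (pc σ)
  have h2 := tedges_perm p k 0 (pc σ')
  rw [pv_zero] at h1 h2
  rw [hπ, hπ, h1, h2, Finset.map_map, ← shiftE_trans_pK, ← Finset.map_map, ← Finset.map_inter, Finset.card_map]

/-- **The certificate functional is invariant under coordinate permutations** (for a closed piece family with
invariant weights and invariant tables). -/
theorem certLHS_perm (pc : Fin np → List (Fin t × Bool)) (w : Fin np → ℝ) (k : ℕ) (x : ℝ)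
    {V0f V1f : (Fin t → ℤ) → ℝ} (p : Equiv.Perm (Fin t)) (π : Fin np ≃ Fin np)
    (hπ : ∀ σ, pc (π σ) = (pc σ).map (pq p)) (hw : ∀ σ, w (π σ) = w σ)
    (hV0 : ∀ u, V0f (pv p u) = V0f u) (hV1 : ∀ u, V1f (pv p u) = V1f u) (y : Fin t → ℤ) :
    certLHS pc w k x V0f V1f (pv p y) = certLHS pc w k x V0f V1f y := by
  unfold certLHS
  rw [← π.sum_comp]
  refine sum_congr rfl fun σ _ => ?_
  rw [← π.sum_comp]
  refine sum_congr rfl fun σ' _ => ?_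
  rw [S_perm pc k p π hπ, hw, hw, hπ, hπ, pend_perm, pend_perm]
  have he : (pv p (pend (pc σ)) = pv p (pend (pc σ')) + pv p y) ↔ (pend (pc σ) = pend (pc σ') + y) := by
    rw [← pv_add]; exact (pv_injective p).eq_iff
  have hu : pv p y + (pv p (pend (pc σ')) - pv p (pend (pc σ))) = pv p (y + (pend (pc σ') - pend (pc σ))) := by
    rw [pv_add, pv_sub]
  rw [hu, hV0, hV1]
  by_cases h : pend (pc σ) = pend (pc σ') + y
  · rw [if_pos h, if_pos (he.2 h)]
  · rw [if_neg h, if_neg (fun h' => h (he.1 h'))]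

/-! ### Coordinate sign flips -/

/-- Negate coordinate `c`. -/
def negC (c : Fin t) (v : Fin t → ℤ) : Fin t → ℤ := fun j => if j = c then -v j else v j

/-- The action on signed axes: flip the sign of the steps along axis `c`. -/
def flipAx (c : Fin t) (q : Fin t × Bool) : Fin t × Bool := if q.1 = c then (q.1, !q.2) else q

/-- `negC` is additive. -/
theorem negC_add (c : Fin t) (v w : Fin t → ℤ) : negC c (v + w) = negC c v + negC c w := by
  funext j; simp only [negC, Pi.add_apply]; split_ifs <;> ring

/-- `negC` commutes with subtraction. -/
theorem negC_sub (c : Fin t) (v w : Fin t → ℤ) : negC c (v - w) = negC c v - negC c w := by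
  funext j; simp only [negC, Pi.sub_apply]; split_ifs <;> ring

/-- `negC c 0 = 0`. -/
theorem negC_zero (c : Fin t) : negC c (0 : Fin t → ℤ) = 0 := by
  funext j; unfold negC; split_ifs <;> simp

/-- `negC` is injective. -/
theorem negC_injective (c : Fin t) : Function.Injective (negC c) := by
  intro v w h
  funext j
  have := congr_fun h j
  unfold negC at this
  split_ifs at this <;> simpa using this

/-- `negC c (± e_c) = ∓ e_c` and `negC c` fixes the other axis vectors: step vectors are equivariant. -/
theorem negC_sv (c : Fin t) (q : Fin t × Bool) : negC c (sv q) = sv (flipAx c q) := by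
  funext j
  unfold negC sv flipAx
  by_cases hq : q.1 = c
  · rw [if_pos hq]
    by_cases hj : j = c
    · subst hj; rw [if_pos rfl, ← hq, Pi.single_eq_same, Pi.single_eq_same]; cases q.2 <;> simp
    · rw [if_neg hj, Pi.single_eq_of_ne (fun h => hj (h.trans hq)), Pi.single_eq_of_ne (fun h => hj (h.trans hq))]
  · rw [if_neg hq]
    by_cases hj : j = c
    · subst hj; rw [if_pos rfl, Pi.single_eq_of_ne (fun h => hq h.symm)]; simp
    · rw [if_neg hj]

/-- The flipped axis keeps its index. -/
theorem flipAx_fst (c : Fin t) (q : Fin t × Bool) : (flipAx c q).1 = q.1 := by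
  unfold flipAx; split_ifs <;> rfl

/-- The correction of the lower vertex of an edge key under the flip: `e_c` for transverse axis `c`, else `0`. -/
def flipCorr (c : Fin t) (k : ℕ) : Fin t ⊕ Fin k → (Fin t → ℤ)
  | Sum.inl j => if j = c then Pi.single c 1 else 0
  | Sum.inr _ => 0

/-- The action of the flip on edge keys (lower vertex convention: an edge along the flipped axis moves its lower
vertex by `-e_c` after negation). -/
def fK (c : Fin t) (k : ℕ) : LKey t k ↪ LKey t k :=
  ⟨fun q => (negC c q.1 - flipCorr c k q.2, q.2), fun q q' h => by
    simp only [Prod.mk.injEq] at h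
    obtain ⟨h1, h2⟩ := h
    refine Prod.ext ?_ h2
    rw [h2] at h1
    exact negC_injective c (sub_left_injective h1)⟩

/-- The head key of `tedges` transforms by `fK` under the flip. -/
theorem fK_headKey (c : Fin t) (k : ℕ) (u : Fin t → ℤ) (q : Fin t × Bool) :
    (if (flipAx c q).2 then (negC c u, (Sum.inl (flipAx c q).1 : Fin t ⊕ Fin k))
      else (negC c u + sv (flipAx c q), Sum.inl (flipAx c q).1)) =
      fK c k (if q.2 then (u, Sum.inl q.1) else (u + sv q, Sum.inl q.1)) := by
  rcases q with ⟨i, b⟩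
  by_cases hi : i = c
  · subst hi
    cases b <;>
      simp only [flipAx, if_true, Bool.not_true, Bool.not_false, Bool.false_eq_true, if_false, fK,
        Function.Embedding.coeFn_mk] <;>
      refine Prod.ext (funext fun j => ?_) rfl <;>
      simp only [Pi.add_apply, Pi.sub_apply, negC, sv, flipCorr, Pi.single_apply, if_true, Bool.false_eq_true,
        if_false] <;>
      split_ifs <;> omega
  · have hq : flipAx c (i, b) = (i, b) := by unfold flipAx; exact if_neg hi
    rw [hq]
    cases b <;>
      simp only [Bool.false_eq_true, if_false, if_true, fK, Function.Embedding.coeFn_mk] <;>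
      refine Prod.ext (funext fun j => ?_) rfl <;>
      simp only [Pi.add_apply, Pi.sub_apply, negC, sv, flipCorr, Pi.single_apply, if_neg hi, Pi.zero_apply] <;>
      split_ifs <;> omega

/-- **Equivariance of the transverse edge keys under a coordinate sign flip.** -/
theorem tedges_flip (c : Fin t) (k : ℕ) : ∀ (u : Fin t → ℤ) (σ : List (Fin t × Bool)),
    tedges k (negC c u) (σ.map (flipAx c)) = (tedges k u σ).map (fK c k)
  | u, [] => by simp [tedges]
  | u, q :: σ => by
    rw [List.map_cons, tedges, tedges, Finset.map_insert, ← fK_headKey, ← tedges_flip c k (u + sv q) σ, negC_add,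
      negC_sv]

/-- Piece endpoints are equivariant under the flip. -/
theorem pend_flip (c : Fin t) : ∀ σ : List (Fin t × Bool), pend (σ.map (flipAx c)) = negC c (pend σ)
  | [] => by simp [pend, negC_zero]
  | q :: σ => by
    have ih := pend_flip c σ
    simp only [pend, List.map_cons, List.sum_cons] at ih ⊢
    rw [ih, negC_add, negC_sv]

/-- Shifts are equivariant under the flip. -/
theorem shiftE_trans_fK (c : Fin t) (k : ℕ) (y : Fin t → ℤ) :
    (shiftE (k := k) y).trans (fK c k) = (fK c k).trans (shiftE (negC c y)) :=
  Function.Embedding.ext fun q => Prod.ext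
    (show negC c (q.1 + y) - flipCorr c k q.2 = negC c q.1 - flipCorr c k q.2 + negC c y by rw [negC_add]; abel) rfl

/-- **`S` is invariant under a coordinate sign flip** of the offset and of the pieces. -/
theorem S_flip (pc : Fin np → List (Fin t × Bool)) (k : ℕ) (c : Fin t) (π : Fin np → Fin np)
    (hπ : ∀ σ, pc (π σ) = (pc σ).map (flipAx c)) (y : Fin t → ℤ) (σ σ' : Fin np) :
    S pc k (negC c y) (π σ) (π σ') = S pc k y σ σ' := by
  unfold S
  have h1 := tedges_flip c k 0 (pc σ)
  have h2 := tedges_flip c k 0 (pc σ')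
  rw [negC_zero] at h1 h2
  rw [hπ, hπ, h1, h2, Finset.map_map, ← shiftE_trans_fK, ← Finset.map_map, ← Finset.map_inter, Finset.card_map]

/-- **The certificate functional is invariant under coordinate sign flips** (closed piece family, invariant weights
and tables). -/
theorem certLHS_flip (pc : Fin np → List (Fin t × Bool)) (w : Fin np → ℝ) (k : ℕ) (x : ℝ)
    {V0f V1f : (Fin t → ℤ) → ℝ} (c : Fin t) (π : Fin np ≃ Fin np)
    (hπ : ∀ σ, pc (π σ) = (pc σ).map (flipAx c)) (hw : ∀ σ, w (π σ) = w σ)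
    (hV0 : ∀ u, V0f (negC c u) = V0f u) (hV1 : ∀ u, V1f (negC c u) = V1f u) (y : Fin t → ℤ) :
    certLHS pc w k x V0f V1f (negC c y) = certLHS pc w k x V0f V1f y := by
  unfold certLHS
  rw [← π.sum_comp]
  refine sum_congr rfl fun σ _ => ?_
  rw [← π.sum_comp]
  refine sum_congr rfl fun σ' _ => ?_
  rw [S_flip pc k c π hπ, hw, hw, hπ, hπ, pend_flip, pend_flip]
  have he : (negC c (pend (pc σ)) = negC c (pend (pc σ')) + negC c y) ↔ (pend (pc σ) = pend (pc σ') + y) := by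
    rw [← negC_add]; exact (negC_injective c).eq_iff
  have hu : negC c y + (negC c (pend (pc σ')) - negC c (pend (pc σ))) = negC c (y + (pend (pc σ') - pend (pc σ))) := by
    rw [negC_add, negC_sub]
  rw [hu, hV0, hV1]
  by_cases h : pend (pc σ) = pend (pc σ') + y
  · rw [if_pos h, if_pos (he.2 h)]
  · rw [if_neg h, if_neg (fun h' => h (he.1 h'))]

/-! ### Invariance of the canonical representative -/

/-- `canonK (-u) = canonK u`. -/
theorem canonK_neg (u : Fin t → ℤ) : canonK (-u) = canonK u := by
  have : absSort (-u) = absSort u := by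
    unfold absSort; exact congr_arg _ (congr_arg _ (funext fun l => abs_neg (u l)))
  funext i; show (absSort (-u)).getD i 0 = (absSort u).getD i 0; rw [this]

/-- `canonK (negC c u) = canonK u`. -/
theorem canonK_negC (c : Fin t) (u : Fin t → ℤ) : canonK (negC c u) = canonK u := by
  have : absSort (negC c u) = absSort u := by
    unfold absSort
    refine congr_arg _ (congr_arg _ (funext fun l => ?_))
    unfold negC; split_ifs <;> simp
  funext i; show (absSort (negC c u)).getD i 0 = (absSort u).getD i 0; rw [this]

/-- `canonK (pv p u) = canonK u`. -/
theorem canonK_pv (p : Equiv.Perm (Fin t)) (u : Fin t → ℤ) : canonK (pv p u) = canonK u := by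
  have hperm : (List.ofFn fun l => |pv p u l|).Perm (List.ofFn fun l => |u l|) := by
    have := Equiv.Perm.ofFn_comp_perm p.symm (fun l => |u l|)
    exact this
  have : absSort (pv p u) = absSort u := by
    unfold absSort
    exact List.Perm.eq_of_pairwise' (List.pairwise_insertionSort _ _) (List.pairwise_insertionSort _ _)
      (((List.perm_insertionSort _ _).trans hperm).trans (List.perm_insertionSort _ _).symm)
  funext i; show (absSort (pv p u)).getD i 0 = (absSort u).getD i 0; rw [this]

end Summit.CriticalPhenomena.PercolationContinuityZ3.Theorems.Pcint.BSM
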